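import Summits.QuantumFields.YangMills.Theorems.BalabanUVNodesN18RunWindowEdge
import Summits.QuantumFields.BalabanUV.T4Continuum.Spine.NE4.Necessity

/-!
# BalabanUVNodes ∕ N18 — THE STEP-MATCHED N18 LETTER (R-N18-SEL): NE5 keyed on the GRAPH OF THE FIRST (0.20) STEP `1∕b² = 1∕(s 0)² + β₁(b)`, ONE letter
# for BOTH consumers of N18 — the N19′ rate edge's selector-keyed `h18` (with the «first-coupling recovery» it displays, proved here) and the U3 → U2 edge
# in PREFIX currency (`NE7MarginalL1Currency.ShiftAlongRun` ⟹ `Spine/NE4/Necessity`'s door BY NAME)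
# (Track A, DAG node N18 = NE5 → its two out-edges; key K3⁸ `SpineGivenEndpointR13SepCoPHV` = stmt-QuantumFields-27366, skeleton v6 b4e55110ab73e679; width seat
# `pub-ymgap-dag-n18-w1` g7 — successor of g6 FILE 1 (`…N18KernelLettersFirstEntryOnly` §3, the run-keyed survivor) and FILE 3 (`…N18RunWindowEdge`, the U3 → U2 edge
# in run-window currency))

HONEST FRAMING.  Count-neutral kernel bookkeeping BY NAME (`--kind proof --supports stmt-QuantumFields-27366 --as helper`): hypothesis SHAPES over landed definitions
plus elementary real analysis (one intermediate-value argument, one Lipschitz contraction).  The step-matched letter, the β-read-out binders (D4), the level-0 β-side binders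
(sign ∕ bound ∕ continuity ∕ Lipschitz modulus of the FIRST β-function) and every regime number (`Λ₀γ³ < 2`, the U2 window) are DISPLAYED HYPOTHESES, asserted ∕ inhabited
nowhere (A6: the zero term family inhabits the letter trivially — LOCATED, the content is Bałaban's η-rate NE5, NOT PRINTED for d = 4); nothing of Bałaban's is asserted,
inhabited, discharged or refuted; N17 ∕ N18 ∕ (D4) NOT discharged; K3⁸ OPEN (v6), no stub proved ∕ refuted, NO skeleton re-keyed by this file (R-N18-SEL is a located
input for the definers ∕ plan, like g6's R-N18-RUN); K3⁷ 20544 aside.  Counts UNMOVED (typed 28∕28 · discharged 5∕27, A 5∕28).  One finite four-torus programme at fixed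
`ε`, Bałaban AS PRINTED; route R4 closes ONLY the conditional finite-𝕋⁴ rung `BalabanLadder.UV` — NOT the continuum limit, NOT ℝ⁴, NOT OS, NOT the Yang–Mills mass gap, NOT
Clay.  THEOREMS ONLY: 0 `def`, 0 `instance`, 0 `sorry`, standard axioms.

WHY.  g6 located (FILE 1 ∕ 2, evidence #40 on 27366) that, modulo the ym-nodeO F-E finding, N18's BOX-keyed conjunct `SpineRates.N18At u = ∀ b ∈ ]0,γ], NE5 u.EA (u.EB b) u.W …`
is presumptively uninhabitable at the pinned kernels of record — it compares run A at a coupling table `s` with run B's member at an INDEPENDENT first coupling `b` — while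
the RUN-keyed comparison survives, and (FILE 3 ∕ 4) that the U3 → U2 edge survives in run-window currency.  Reading the two CONSUMERS of N18 first-hand shows the honest
keying is neither the box nor a run bookkeeping but the GRAPH OF THE FIRST (0.20) STEP:
* the N19′ rate edge (`…N19RateEdge.rateEdge_of_linkReading` :95 ff.) consumes N18 ONLY as `h18 : NE5 R.u3.EA (fun s ↦ R.u3.EB (bsel s) s) R.u3.W …` — run A at `s`
  against run B's member at a SELECTED first coupling `bsel s` (`ne5_of_n18At` builds it from the box conjunct) — at the price its docstring DISPLAYS: «first-coupling recovery
  `bsel (fun i ↦ g (K+1) (i+1)) = g (K+1) 0` (at the flows of record the (0.20) step is injective in g₀ on the small box)»; in every landed link reading `bsel` stays ∃-bound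
  and the recovery is nobody's theorem;
* the U3 → U2 consumer (`T4CouplingMatching.disc_step` :489, `Spine/NE4/Necessity.disc_le_of_shiftAlong_geom` :186) reads N17 ONLY at run B's PREFIX windows
  `(g^B_0; g^B_1, …, g^B_{j+1})` — `NE7MarginalL1Currency.ShiftAlongRun σ β g^B K` — and there run B's first coupling `g^B_0` IS the (0.20)-predecessor of `g^B_1`
  (`RGEqH` at `k = 0`: `1∕(g^B_0)² = 1∕(g^B_1)² + β 0 (g^B_0)`).
So ONE letter — NE5 at the STEP-MATCHED pairs `(b, s)`, `1∕b² = 1∕(s 0)² + β 0 (b)` — feeds both: (α) with a RECOVERING selector it IS the N19′ edge's `h18` on any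
`W ⊆ Window γ` (§2); (β) with the (D4) read-out it gives `ShiftAlongRun (cr·C₅·θ·θ^·) β g^B K` along every in-window run (g6 FILE 3 §1 `shift_le_of_ne5At` at the prefix
windows), hence node U2's output on the datum by `Necessity.u2Output_of_ne4AlongRuns` BY NAME (§3); (γ) the recovering selector EXISTS (choice, hypothesis-free) and RECOVERS
run heads under first-step injectivity `Λ₀γ³ < 2` (`T4TwoRunUniqueness.abs_sub_le_half_cube`; `Λ₀` = `HistLipschitz`'s level-0 modulus), predecessors exist under the level-0
sign ∕ bound ∕ continuity (§1).  Box ⟹ step-matched trivially; under injectivity step-matched ⟺ selector-keyed NE5 at the recovering selector (§2).  No run bookkeeping in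
`U3Carriers`, no change to `ReadOutAt` (its first clause `W ⊇` padded boxes stays harmless: the letter's only extra quantifier is the matching condition).

WHAT (theorems only).  §1 the first (0.20) step (`FlowStep` currency, level 0 only): `prefixOf_zero_eq_const` · `pred_le_of_sign` · ★ `exists_pred_of_sign_upper_cont` (IVT) ·
★ `pred_unique_of_lipschitz₀` · `lipschitz₀_of_histLipschitz` · ★ `exists_selector` (hypothesis-free) · ★★ `selector_recovers_of_unique` · ★★ `selector_recovers_head_of_rgEqH`.
§2 abstract carriers (`T4OutputRate` ∕ `T4BetaReadOut` currency): `stepMatched_of_boxLetter` · ★★ `ne5_selector_of_stepMatched` (⟹ the N19′ `h18` shape) ·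
`exists_selector_ne5_of_stepMatched` · `stepMatched_of_ne5_selector` (converse under uniqueness) · ★★ `shiftAlongRun_of_stepMatched` (⟹ the U2 door's input, `RGEqH` used at
step 0 only).  §3 K3 carriers (`YMDAG.UVSplit`): `stepMatched_of_n18At` · `ne5_selector_of_stepMatched_carriers` · ★ `exists_selector_ne5_recovers_carriers` (the N19′ link
reading's `hbsel` + `h18` + «first-coupling recovery» from the letter) · ★★ `shiftAlongRun_of_readOutAt_stepMatched` · `shiftAlongRun_runFlow_of_readOutAt_stepMatched`
(run `K+1` of a tuned sequence, `rgEqH_of_tuned`) · ★ `u2Output_of_readOutAt_stepMatched` (+ the history half + AF binders + window ⟹ `U2Output D g₀ (2c∕(1−ρ)) ρ`,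
`c = cr·C₅·θ`, `Necessity.u2Output_of_ne4AlongRuns` BY NAME — the step-matched twin of `Spine/NE4/Targets.u2Output_of_u3`).

References (TYPES ∕ locators only): [Balaban1987RG1] CMP **109** (1987): (0.18)–(0.20) pp. 255–256, Thm 1 ∕ 2 p. 259, (1.20)–(1.22) ∕ Thm 3 p. 264, §5 p. 298.
-/

noncomputable section

namespace YMDAG.N18.StepMatchedLetter

open Literature.MathematicalPhysics.QuantumFieldTheory.Balaban1983to89
open Literature.MathematicalPhysics.QuantumFieldTheory.Balaban1983to89.T4Continuum (T4Family)
open Literature.MathematicalPhysics.QuantumFieldTheory.Balaban1983to89.FlowStep (Box HBeta mem_box prefixOf prefixOf_apply RGEqH BetaUpperH)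
open Literature.MathematicalPhysics.QuantumFieldTheory.Balaban1983to89.T4CouplingMatching (HistLipschitz FadingMemory EventualLowerH tail_prefixOf prefixOf_mem_box)
open Literature.MathematicalPhysics.QuantumFieldTheory.Balaban1983to89.T4TwoRunUniqueness (abs_sub_le_half_cube rgEqH_of_tuned)
open Literature.MathematicalPhysics.QuantumFieldTheory.Balaban1983to89.T4OutputRate (Carriers Functional Window NE5 mem_window)
open Literature.MathematicalPhysics.QuantumFieldTheory.Balaban1983to89.T4FlagMemory (extd extd_coe tail_mem_box)
open Literature.MathematicalPhysics.QuantumFieldTheory.Balaban1983to89.T4FlagMemoryTwoRun (extd_prefixOf)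
open Literature.MathematicalPhysics.QuantumFieldTheory.Balaban1983to89.T4BetaReadOut (Slice ReadOut RepresentsA RepresentsB)
open Literature.MathematicalPhysics.QuantumFieldTheory.Balaban1983to89.T4BetaReadOutLipschitz (ReadCovariantOn)
open Summit.QuantumFields.BalabanUV.T4Continuum.NE7MarginalL1Currency (ShiftAlongRun)
open Summit.QuantumFields.BalabanUV.T4Continuum.Spine.NE4 (runFlow U2Output u2Output_of_ne4AlongRuns box_and_pin_of_tuned)
open YMDAG.N18.RunWindowEdge (shift_le_of_ne5At)
open YMDAG.UVSplit

/-! ## §1 The first (0.20) step: predecessors, their uniqueness, and the recovering selector (level 0 of `β : HBeta` only)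

Throughout, «`b` is a (0.20)-PREDECESSOR of `x`» means `1 ∕ b ^ 2 = 1 ∕ x ^ 2 + β 0 (fun _ ↦ b)` — the first renormalization-group step (0.20) of [Balaban1987RG1] p. 256
from the bare coupling `g₀ = b` to `g₁ = x` with the first β-function `β₁(g₀) = β 0 (g₀)` (`FlowStep.RGEqH` at `k = 0`; the prefix `(g₀)` is the constant `Fin 1`-vector). -/

/-- The `Fin 1`-prefix of a coupling sequence is the constant vector at its bare coupling. [folklore] -/
theorem prefixOf_zero_eq_const (g : ℕ → ℝ) : prefixOf g 0 = fun _ => g 0 := by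
  funext i
  have hi : (i : ℕ) = 0 := by have := i.isLt; omega
  rw [prefixOf_apply, hi]

/-- Under the SIGN of the first β-function at `b` (asymptotic freedom's weakest form, `0 ≤ β₁(b)`; NOT asserted in print, [Balaban1987RG1] p. 264 defers it), a
(0.20)-predecessor `b` of `x` lies below `x`: the coupling grows along the step. [cite: Balaban1987RG1, (0.20) p.256 and Thm 2 p.259] -/
theorem pred_le_of_sign {β : HBeta} {b x : ℝ} (hb : 0 < b) (hx : 0 < x) (hsign : 0 ≤ β 0 (fun _ => b))
    (hm : 1 / b ^ 2 = 1 / x ^ 2 + β 0 (fun _ => b)) : b ≤ x := by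
  have h1 : 1 / x ^ 2 ≤ 1 / b ^ 2 := by rw [hm]; linarith
  have h2 : b ^ 2 ≤ x ^ 2 := by rwa [one_div_le_one_div (pow_pos hx 2) (pow_pos hb 2)] at h1
  exact (pow_le_pow_iff_left₀ hb.le hx.le two_ne_zero).mp h2

/-- ★ **PREDECESSORS EXIST** under the level-0 β-side binders (all DISPLAYED, none printed as facts: sign `0 ≤ β₁`, bound `β₁ ≤ β′`, continuity of `β₁` on `]0,γ]` —
[Balaban1987RG1] p. 263–264 «C^∞-function of g … (or analytic)», «uniformly bounded»; the sign is Thm 2's unprinted input): every `x ∈ ]0,γ]` has a (0.20)-predecessor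
`b ∈ ]0, x]`.  Intermediate value theorem for `b ↦ 1∕b² − β₁(b)` on `[b₁, x]` with `1∕b₁² = 1∕x² + max β′ 0 + 1`. [cite: Balaban1987RG1, (0.20) p.256 and §1 pp.263–264] -/
theorem exists_pred_of_sign_upper_cont {β : HBeta} {γ β' : ℝ}
    (hcont : ContinuousOn (fun b : ℝ => β 0 (fun _ => b)) (Set.Ioc 0 γ))
    (hsign : ∀ b, 0 < b → b ≤ γ → 0 ≤ β 0 (fun _ => b)) (hup : ∀ b, 0 < b → b ≤ γ → β 0 (fun _ => b) ≤ β')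
    {x : ℝ} (hx : 0 < x) (hxγ : x ≤ γ) :
    ∃ b, 0 < b ∧ b ≤ x ∧ 1 / b ^ 2 = 1 / x ^ 2 + β 0 (fun _ => b) := by
  set y : ℝ := 1 / x ^ 2 + max β' 0 + 1 with hy
  have hx2 : 0 < 1 / x ^ 2 := by positivity
  have hypos : 0 < y := by rw [hy]; positivity
  set b₁ : ℝ := 1 / Real.sqrt y with hb₁
  have hb₁pos : 0 < b₁ := by rw [hb₁]; positivity
  have hb₁sq : b₁ ^ 2 = 1 / y := by rw [hb₁, div_pow, one_pow, Real.sq_sqrt hypos.le]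
  have hb₁inv : 1 / b₁ ^ 2 = y := by rw [hb₁sq, one_div_one_div]
  have hb₁x : b₁ ≤ x := by
    refine (pow_le_pow_iff_left₀ hb₁pos.le hx.le two_ne_zero).mp ?_
    rw [hb₁sq, ← one_div_one_div (x ^ 2)]
    exact one_div_le_one_div_of_le hx2 (by rw [hy]; linarith [le_max_right β' 0])
  -- the function `Ψ b = 1/b² − β₁(b)` on `[b₁, x] ⊆ ]0, γ]`
  set Ψ : ℝ → ℝ := fun b => 1 / b ^ 2 - β 0 (fun _ => b) with hΨ
  have hsub : Set.Icc b₁ x ⊆ Set.Ioc 0 γ := fun b hb => ⟨hb₁pos.trans_le hb.1, hb.2.trans hxγ⟩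
  have hcΨ : ContinuousOn Ψ (Set.Icc b₁ x) := ContinuousOn.sub
    (ContinuousOn.div continuousOn_const (continuousOn_pow 2) fun b hb => pow_ne_zero 2 (hb₁pos.trans_le hb.1).ne') (hcont.mono hsub)
  have hΨx : Ψ x ≤ 1 / x ^ 2 := by have := hsign x hx hxγ; simp only [hΨ]; linarith
  have hΨb₁ : 1 / x ^ 2 ≤ Ψ b₁ := by
    have := hup b₁ hb₁pos (hb₁x.trans hxγ); have hmax : β' ≤ max β' 0 := le_max_left _ _
    simp only [hΨ]; rw [hb₁inv, hy]; linarith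
  obtain ⟨b, hbmem, hbΨ⟩ := intermediate_value_Icc' hb₁x hcΨ ⟨hΨx, hΨb₁⟩
  refine ⟨b, hb₁pos.trans_le hbmem.1, hbmem.2, ?_⟩
  simp only [hΨ] at hbΨ
  linarith

/-- ★ **PREDECESSORS ARE UNIQUE under first-step injectivity** — a Lipschitz modulus `Λ₀` of the first β-function on `]0,γ]` with `Λ₀γ³ < 2` (the linearised injectivity threshold of
`b ↦ 1∕b² − β₁(b)`: `|β₁′| ≤ Λ₀ < 2∕γ³ ≤ |(1∕b²)′|`, `T4TwoRunUniqueness.abs_sub_le_half_cube`; the regime number is DISPLAYED, nothing printed verifies it — [Balaban1987RG1]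
Thm 3 p. 264 «The constant γ depends on all other constants»): two predecessors in `]0,γ]` of the same `x` coincide. [cite: Balaban1987RG1, (0.20) p.256 and Thm 3 p.264] -/
theorem pred_unique_of_lipschitz₀ {β : HBeta} {γ Λ₀ : ℝ}
    (hLip : ∀ b b', 0 < b → b ≤ γ → 0 < b' → b' ≤ γ → |β 0 (fun _ => b) - β 0 (fun _ => b')| ≤ Λ₀ * |b - b'|)
    (hsmall : Λ₀ * γ ^ 3 < 2) {b b' x : ℝ} (hb : 0 < b) (hbγ : b ≤ γ) (hb' : 0 < b') (hb'γ : b' ≤ γ)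
    (hm : 1 / b ^ 2 = 1 / x ^ 2 + β 0 (fun _ => b)) (hm' : 1 / b' ^ 2 = 1 / x ^ 2 + β 0 (fun _ => b')) : b = b' := by
  have hγ : 0 < γ := hb.trans_le hbγ
  have hdiff : 1 / b ^ 2 - 1 / b' ^ 2 = β 0 (fun _ => b) - β 0 (fun _ => b') := by rw [hm, hm']; ring
  have h1 : |b - b'| ≤ γ ^ 3 / 2 * |1 / b ^ 2 - 1 / b' ^ 2| := abs_sub_le_half_cube hb hbγ hb' hb'γ
  rw [hdiff] at h1
  have h3 : |b - b'| ≤ γ ^ 3 / 2 * Λ₀ * |b - b'| :=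
    calc |b - b'| ≤ γ ^ 3 / 2 * |β 0 (fun _ => b) - β 0 (fun _ => b')| := h1
      _ ≤ γ ^ 3 / 2 * (Λ₀ * |b - b'|) := mul_le_mul_of_nonneg_left (hLip b b' hb hbγ hb' hb'γ) (by positivity)
      _ = γ ^ 3 / 2 * Λ₀ * |b - b'| := by ring
  have hq : γ ^ 3 / 2 * Λ₀ < 1 := by nlinarith [hsmall, pow_pos hγ 3]
  by_contra hne
  have hpos : 0 < |b - b'| := abs_pos.mpr (sub_ne_zero.mpr hne)
  exact absurd (h3.trans_lt (mul_lt_of_lt_one_left hpos hq)) (lt_irrefl _)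

/-- The level-0 instance of node U2's history moduli: `HistLipschitz Λ γ β` at `k = 0` IS a Lipschitz modulus `Λ 0 0` of the first β-function on `]0,γ]` (the `Fin 1`-sum has one
term). [cite: Balaban1987RG1, §1 p.264 and §5 p.298] -/
theorem lipschitz₀_of_histLipschitz {β : HBeta} {γ : ℝ} {Λ : ℕ → ℕ → ℝ} (hL : HistLipschitz Λ γ β) :
    ∀ b b', 0 < b → b ≤ γ → 0 < b' → b' ≤ γ → |β 0 (fun _ => b) - β 0 (fun _ => b')| ≤ Λ 0 0 * |b - b'| := by
  intro b b' hb hbγ hb' hb'γ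
  have h := hL 0 (fun _ => b) (fun _ => b') (mem_box.mpr fun _ => ⟨hb, hbγ⟩) (mem_box.mpr fun _ => ⟨hb', hb'γ⟩)
  simpa using h

/-- ★ **A SELECTOR EXISTS** (hypothesis-free; choice): a map `bsel : (ℕ → ℝ) → ℝ` on coupling tables which (i) sends the window `]0,γ]^ℕ` into `]0,γ]` (the N19′ link reading's
`hbsel : ∀ s ∈ R.u3.W, 0 < bsel s ∧ bsel s ≤ R.u3.γ` for any `W ⊆ Window γ`) and (ii) returns a (0.20)-predecessor in `]0,γ]` of the table's first entry `s 0` WHENEVER one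
exists (else falls back to `s 0`).  Nothing about `β` is assumed. [folklore] -/
theorem exists_selector (β : HBeta) (γ : ℝ) :
    ∃ bsel : (ℕ → ℝ) → ℝ,
      (∀ s ∈ Window γ, 0 < bsel s ∧ bsel s ≤ γ) ∧
      (∀ s : ℕ → ℝ, (∃ b, 0 < b ∧ b ≤ γ ∧ 1 / b ^ 2 = 1 / (s 0) ^ 2 + β 0 (fun _ => b)) →
        0 < bsel s ∧ bsel s ≤ γ ∧ 1 / (bsel s) ^ 2 = 1 / (s 0) ^ 2 + β 0 (fun _ => bsel s)) := by
  classical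
  refine ⟨fun s => if h : ∃ b, 0 < b ∧ b ≤ γ ∧ 1 / b ^ 2 = 1 / (s 0) ^ 2 + β 0 (fun _ => b) then h.choose else s 0, ?_, ?_⟩
  · intro s hs
    by_cases h : ∃ b, 0 < b ∧ b ≤ γ ∧ 1 / b ^ 2 = 1 / (s 0) ^ 2 + β 0 (fun _ => b)
    · simp only [dif_pos h]
      exact ⟨h.choose_spec.1, h.choose_spec.2.1⟩
    · simp only [dif_neg h]
      exact (mem_window.mp hs) 0
  · intro s h
    simp only [dif_pos h]
    exact h.choose_spec

/-- ★★ **A PREDECESSOR-RETURNING SELECTOR RECOVERS THE FIRST COUPLING under uniqueness**: if `bsel` returns a predecessor whenever one exists (§1 `exists_selector` (ii)) and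
predecessors in `]0,γ]` are unique (`pred_unique_of_lipschitz₀`), then at every step-matched pair `(b, s)` with `b ∈ ]0,γ]` the selector returns `b` itself. [folklore] -/
theorem selector_recovers_of_unique {β : HBeta} {γ : ℝ} {bsel : (ℕ → ℝ) → ℝ}
    (hsel : ∀ s : ℕ → ℝ, (∃ b, 0 < b ∧ b ≤ γ ∧ 1 / b ^ 2 = 1 / (s 0) ^ 2 + β 0 (fun _ => b)) →
      0 < bsel s ∧ bsel s ≤ γ ∧ 1 / (bsel s) ^ 2 = 1 / (s 0) ^ 2 + β 0 (fun _ => bsel s))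
    (huniq : ∀ b b' x : ℝ, 0 < b → b ≤ γ → 0 < b' → b' ≤ γ →
      1 / b ^ 2 = 1 / x ^ 2 + β 0 (fun _ => b) → 1 / b' ^ 2 = 1 / x ^ 2 + β 0 (fun _ => b') → b = b')
    {b : ℝ} {s : ℕ → ℝ} (hb : 0 < b) (hbγ : b ≤ γ) (hm : 1 / b ^ 2 = 1 / (s 0) ^ 2 + β 0 (fun _ => b)) :
    bsel s = b := by
  obtain ⟨h1, h2, h3⟩ := hsel s ⟨b, hb, hbγ, hm⟩
  exact huniq _ _ _ h1 h2 hb hbγ h3 hm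

/-- ★★ **«FIRST-COUPLING RECOVERY» — the N19′ rate edge's displayed identification `bsel (fun i ↦ g (K+1) (i+1)) = g (K+1) 0` as a THEOREM**
(`…N19RateEdge`'s LOCATED TYPING NOTE «at the flows of record the (0.20) step is injective in `g₀` on the small box»): for a run `gs` of (0.20) with at least one step and its bare
coupling in `]0,γ]`, a predecessor-returning selector under uniqueness, applied to the SHIFTED table `i ↦ gs (i+1)`, returns the bare coupling `gs 0`.
[cite: Balaban1987RG1, (0.18)–(0.20) pp.255–256] -/
theorem selector_recovers_head_of_rgEqH {β : HBeta} {γ : ℝ} {bsel : (ℕ → ℝ) → ℝ}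
    (hsel : ∀ s : ℕ → ℝ, (∃ b, 0 < b ∧ b ≤ γ ∧ 1 / b ^ 2 = 1 / (s 0) ^ 2 + β 0 (fun _ => b)) →
      0 < bsel s ∧ bsel s ≤ γ ∧ 1 / (bsel s) ^ 2 = 1 / (s 0) ^ 2 + β 0 (fun _ => bsel s))
    (huniq : ∀ b b' x : ℝ, 0 < b → b ≤ γ → 0 < b' → b' ≤ γ →
      1 / b ^ 2 = 1 / x ^ 2 + β 0 (fun _ => b) → 1 / b' ^ 2 = 1 / x ^ 2 + β 0 (fun _ => b') → b = b')
    {n : ℕ} {gs : ℕ → ℝ} (hR : RGEqH n β gs) (hn : 1 ≤ n) (h0 : 0 < gs 0 ∧ gs 0 ≤ γ) :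
    bsel (fun i => gs (i + 1)) = gs 0 := by
  have hstep := hR 0 (by omega)
  rw [prefixOf_zero_eq_const] at hstep
  exact selector_recovers_of_unique hsel huniq h0.1 h0.2 (by simpa using hstep)

/-! ## §2 Abstract carriers: the STEP-MATCHED letter — between the box letter and the run instances; ⟹ the N19′ `h18` shape; ⟹ `ShiftAlongRun` (the U2 door's input)

THE STEP-MATCHED N18 LETTER at `(EA, EB, W, β, γ, κ, θ, C₅)` (spelled inline in every statement, no definition minted):
`∀ b ∈ ]0,γ], ∀ s ∈ W, 1∕b² = 1∕(s 0)² + β 0 (b) → ∀ U X, |EA s (transport U) X − EB b s U X| ≤ C₅·θ^{scale X}·e^{−κ d X}` — NE5 for run B's member at first coupling `b`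
asked ONLY at the tables `s` whose first entry `s 0` is the (0.20)-successor of `b`: run A's bare coupling is run B's coupling after ONE renormalization step, the two runs then
share the table.  Under first-entry-only kernels (g6 FILE 1) this compares `f_k(step b)` with `f_{k+1}(b)` — the transport-consistent pairs — and nothing else. -/

section Abstract

variable {C : Carriers}

/-- The BOX letter (`SpineRates.N18At`'s shape: NE5 for EVERY first coupling `b ∈ ]0,γ]` on all of `W`) implies the step-matched letter (drop the matching condition).
[cite: Balaban1987RG1, Thm 1 p.259] -/
theorem stepMatched_of_boxLetter {W : Set (ℕ → ℝ)} {EA : Functional C C.BgA} {EB : ℝ → Functional C C.BgB} {β : HBeta} {γ κ θ C₅ : ℝ}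
    (h5 : ∀ b, 0 < b → b ≤ γ → NE5 EA (EB b) W κ θ C₅) :
    ∀ b, 0 < b → b ≤ γ → ∀ s ∈ W, 1 / b ^ 2 = 1 / (s 0) ^ 2 + β 0 (fun _ => b) →
      ∀ (U : C.BgB) (X : C.Dom), |EA s (C.transport U) X - EB b s U X| ≤ C₅ * θ ^ C.scale X * Real.exp (-(κ * C.d X)) :=
  fun b hb hbγ s hs _ U X => h5 b hb hbγ s hs U X

/-- ★★ **THE STEP-MATCHED LETTER + A RECOVERING SELECTOR ⟹ THE N19′ RATE EDGE's `h18` SHAPE `NE5 EA (fun s ↦ EB (bsel s) s) W κ θ C₅`** (what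
`…N19RateEdge.rateEdge_of_linkReading` consumes of N18, there built from the box conjunct by `ne5_of_n18At`): if `bsel` returns on `W` a step-matched first coupling in `]0,γ]`,
the selector-keyed NE5 on `W` is an instance of the letter. [cite: Balaban1987RG1, Thm 1 p.259 and (0.20) p.256] -/
theorem ne5_selector_of_stepMatched {W : Set (ℕ → ℝ)} {EA : Functional C C.BgA} {EB : ℝ → Functional C C.BgB} {β : HBeta} {γ κ θ C₅ : ℝ}
    (hSM : ∀ b, 0 < b → b ≤ γ → ∀ s ∈ W, 1 / b ^ 2 = 1 / (s 0) ^ 2 + β 0 (fun _ => b) →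
      ∀ (U : C.BgB) (X : C.Dom), |EA s (C.transport U) X - EB b s U X| ≤ C₅ * θ ^ C.scale X * Real.exp (-(κ * C.d X)))
    {bsel : (ℕ → ℝ) → ℝ}
    (hbsel : ∀ s ∈ W, 0 < bsel s ∧ bsel s ≤ γ ∧ 1 / (bsel s) ^ 2 = 1 / (s 0) ^ 2 + β 0 (fun _ => bsel s)) :
    NE5 EA (fun s => EB (bsel s) s) W κ θ C₅ :=
  fun s hs U X => hSM (bsel s) (hbsel s hs).1 (hbsel s hs).2.1 s hs (hbsel s hs).2.2 U X

/-- **… WITH THE SELECTOR PRODUCED** (§1): on a coupling set `W ⊆ Window γ`, if every `x ∈ ]0,γ]` has a predecessor in `]0,γ]` (e.g. `exists_pred_of_sign_upper_cont`), the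
step-matched letter yields a selector with the N19′ link reading's `hbsel` clause AND its `h18` — no box letter needed. [cite: Balaban1987RG1, Thm 1 p.259 and (0.20) p.256] -/
theorem exists_selector_ne5_of_stepMatched {W : Set (ℕ → ℝ)} {EA : Functional C C.BgA} {EB : ℝ → Functional C C.BgB} {β : HBeta} {γ κ θ C₅ : ℝ}
    (hSM : ∀ b, 0 < b → b ≤ γ → ∀ s ∈ W, 1 / b ^ 2 = 1 / (s 0) ^ 2 + β 0 (fun _ => b) →
      ∀ (U : C.BgB) (X : C.Dom), |EA s (C.transport U) X - EB b s U X| ≤ C₅ * θ ^ C.scale X * Real.exp (-(κ * C.d X)))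
    (hWγ : W ⊆ Window γ)
    (hpred : ∀ x, 0 < x → x ≤ γ → ∃ b, 0 < b ∧ b ≤ γ ∧ 1 / b ^ 2 = 1 / x ^ 2 + β 0 (fun _ => b)) :
    ∃ bsel : (ℕ → ℝ) → ℝ, (∀ s ∈ Window γ, 0 < bsel s ∧ bsel s ≤ γ) ∧
      (∀ s : ℕ → ℝ, (∃ b, 0 < b ∧ b ≤ γ ∧ 1 / b ^ 2 = 1 / (s 0) ^ 2 + β 0 (fun _ => b)) →
        0 < bsel s ∧ bsel s ≤ γ ∧ 1 / (bsel s) ^ 2 = 1 / (s 0) ^ 2 + β 0 (fun _ => bsel s)) ∧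
      NE5 EA (fun s => EB (bsel s) s) W κ θ C₅ := by
  obtain ⟨bsel, hwin, hsel⟩ := exists_selector β γ
  refine ⟨bsel, hwin, hsel, ne5_selector_of_stepMatched hSM fun s hs => hsel s ?_⟩
  have hs0 : 0 < s 0 ∧ s 0 ≤ γ := (mem_window.mp (hWγ hs)) 0
  exact hpred (s 0) hs0.1 hs0.2

/-- **CONVERSE under uniqueness**: if predecessors in `]0,γ]` are unique and `bsel` returns one whenever it exists, the selector-keyed NE5 on `W` gives back the step-matched
letter on `W` (at a matched pair `(b, s)` the selector returns `b`).  So, under first-step injectivity, the step-matched letter and «NE5 at the recovering selector» are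
EQUIVALENT keyings — the second is the one the N19′ edge already reads. [cite: Balaban1987RG1, Thm 1 p.259 and (0.20) p.256] -/
theorem stepMatched_of_ne5_selector {W : Set (ℕ → ℝ)} {EA : Functional C C.BgA} {EB : ℝ → Functional C C.BgB} {β : HBeta} {γ κ θ C₅ : ℝ}
    {bsel : (ℕ → ℝ) → ℝ}
    (hsel : ∀ s : ℕ → ℝ, (∃ b, 0 < b ∧ b ≤ γ ∧ 1 / b ^ 2 = 1 / (s 0) ^ 2 + β 0 (fun _ => b)) →
      0 < bsel s ∧ bsel s ≤ γ ∧ 1 / (bsel s) ^ 2 = 1 / (s 0) ^ 2 + β 0 (fun _ => bsel s))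
    (huniq : ∀ b b' x : ℝ, 0 < b → b ≤ γ → 0 < b' → b' ≤ γ →
      1 / b ^ 2 = 1 / x ^ 2 + β 0 (fun _ => b) → 1 / b' ^ 2 = 1 / x ^ 2 + β 0 (fun _ => b') → b = b')
    (h18 : NE5 EA (fun s => EB (bsel s) s) W κ θ C₅) :
    ∀ b, 0 < b → b ≤ γ → ∀ s ∈ W, 1 / b ^ 2 = 1 / (s 0) ^ 2 + β 0 (fun _ => b) →
      ∀ (U : C.BgB) (X : C.Dom), |EA s (C.transport U) X - EB b s U X| ≤ C₅ * θ ^ C.scale X * Real.exp (-(κ * C.d X)) := by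
  intro b hb hbγ s hs hm U X
  have hrec : bsel s = b := selector_recovers_of_unique hsel huniq hb hbγ hm
  have h : |EA s (C.transport U) X - EB (bsel s) s U X| ≤ C₅ * θ ^ C.scale X * Real.exp (-(κ * C.d X)) := h18 s hs U X
  rw [hrec] at h
  exact h

/-- ★★ **THE STEP-MATCHED LETTER + THE READ-OUT (R) ⟹ NE4 ALONG RUN B's PREFIXES, `NE7MarginalL1Currency.ShiftAlongRun (fun j ↦ cr·C₅·θ·θ^j) β g^B K`** — the input of
`Spine/NE4/Necessity.disc_le_of_shiftAlong_geom` ∕ `u2Output_of_ne4AlongRuns`, i.e. ALL that node U2's coupling matching (`T4CouplingMatching.disc_step`) reads of N17.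
Hypotheses (all DISPLAYED): the read-outs representing `β` on the `γ`-boxes (`RepresentsA ∕ B`), transport covariance on classes containing the slices over a coupling set
`W ⊇` padded boxes, the step-matched letter on `W`, and a sequence `g^B` with couplings in `]0,γ]` up to index `K+1` obeying (0.20) AT ITS FIRST STEP ONLY.  Proof: pv∕t4's
liaison at ONE history (g6 FILE 3 §1 `shift_le_of_ne5At`) at the prefix window `w = (g^B_0, …, g^B_{j+1})`, whose pair `(w 0; extd (tail w))` is step-matched by (0.20) at
`k = 0`. [cite: Balaban1987RG1, (0.18)–(0.20) pp.255–256, (1.20)–(1.22) p.264, Thm 1 p.259] -/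
theorem shiftAlongRun_of_stepMatched {W : Set (ℕ → ℝ)} {EA : Functional C C.BgA} {EB : ℝ → Functional C C.BgB}
    {𝒜A : Set (Slice C C.BgA)} {𝒜B : Set (Slice C C.BgB)} {rA : ReadOut C C.BgA} {rB : ReadOut C C.BgB} {β : HBeta} {γ κ θ C₅ cr : ℝ}
    (hW : ∀ k (v : Fin (k + 1) → ℝ), v ∈ Box γ k → extd v ∈ W)
    (hSM : ∀ b, 0 < b → b ≤ γ → ∀ s ∈ W, 1 / b ^ 2 = 1 / (s 0) ^ 2 + β 0 (fun _ => b) →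
      ∀ (U : C.BgB) (X : C.Dom), |EA s (C.transport U) X - EB b s U X| ≤ C₅ * θ ^ C.scale X * Real.exp (-(κ * C.d X)))
    (hA : RepresentsA EA rA γ β) (hB : RepresentsB EB rB γ β)
    (h𝒜A : ∀ g ∈ W, EA g ∈ 𝒜A) (h𝒜B : ∀ b, 0 < b → b ≤ γ → ∀ g ∈ W, EB b g ∈ 𝒜B) (hcov : ReadCovariantOn 𝒜A 𝒜B rA rB κ cr)
    {K : ℕ} {gB : ℕ → ℝ} (hstep0 : 1 / (gB 0) ^ 2 = 1 / (gB 1) ^ 2 + β 0 (fun _ => gB 0))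
    (hbox : ∀ i, i ≤ K + 1 → 0 < gB i ∧ gB i ≤ γ) :
    ShiftAlongRun (fun j => cr * C₅ * θ * θ ^ j) β gB K := by
  intro j hj
  have hw : prefixOf gB (j + 1) ∈ Box γ (j + 1) := prefixOf_mem_box (N := K + 1) (by omega) hbox
  have htail : Fin.tail (prefixOf gB (j + 1)) = prefixOf (fun n => gB (n + 1)) j := tail_prefixOf gB j
  have hg : extd (Fin.tail (prefixOf gB (j + 1))) ∈ W := hW j _ (tail_mem_box hw)
  have hb : 0 < gB 0 ∧ gB 0 ≤ γ := hbox 0 (by omega)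
  have hw0 : prefixOf gB (j + 1) 0 = gB 0 := by simp [prefixOf_apply]
  have hs0 : extd (Fin.tail (prefixOf gB (j + 1))) 0 = gB 1 := by
    rw [htail]
    have h := extd_prefixOf (g := fun n => gB (n + 1)) (N := j) (m := 0) (Nat.zero_le j)
    simpa using h
  refine shift_le_of_ne5At hA hB hcov hw (h𝒜A _ hg) (by rw [hw0]; exact h𝒜B (gB 0) hb.1 hb.2 _ hg) ?_
  intro U X hX
  rw [hw0]
  have h := hSM (gB 0) hb.1 hb.2 _ hg (by rw [hs0]; exact hstep0) U X
  rw [hX] at h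
  exact h

end Abstract

/-! ## §3 K3 currency (`YMDAG.UVSplit`): the letter at node U3's carriers `u : U3Carriers`; the N19′ `h18` at `R.u3`; the (D4) binder `ReadOutAt D u` ⟹ `ShiftAlongRun` along the
datum's runs ⟹ node U2's output on the datum (`Spine/NE4/Necessity` BY NAME) -/

section Carriers

variable {F : T4Family} {N : ℕ} [NeZero N]

/-- The box conjunct `N18At u` of K3's rates predicate implies the step-matched letter at `u` for EVERY β-family (the matching condition is simply dropped) — so re-keying
`N18At` to the step-matched letter WEAKENS the stub. [cite: Balaban1987RG1, Thm 1 p.259] -/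
theorem stepMatched_of_n18At {u : U3Carriers} (h18 : N18At u) (β : HBeta) :
    ∀ b, 0 < b → b ≤ u.γ → ∀ s ∈ u.W, 1 / b ^ 2 = 1 / (s 0) ^ 2 + β 0 (fun _ => b) →
      ∀ (U : u.C.BgB) (X : u.C.Dom), |u.EA s (u.C.transport U) X - u.EB b s U X| ≤ u.C₅ * u.θ ^ u.C.scale X * Real.exp (-(u.κ * u.C.d X)) :=
  fun b hb hbγ s hs _ U X => h18 b hb hbγ s hs U X

/-- **THE N19′ RATE EDGE's `h18` AT `R.u3` FROM THE STEP-MATCHED LETTER** (`rateEdge_of_linkReading`'s `h18 : NE5 R.u3.EA (fun s ↦ R.u3.EB (bsel s) s) R.u3.W R.u3.κ R.u3.θ R.u3.C₅`,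
there obtained from `RatesAt`'s box conjunct by `ne5_of_n18At`): §2 at `C := u.C`. [cite: Balaban1987RG1, Thm 1 p.259 and (0.20) p.256] -/
theorem ne5_selector_of_stepMatched_carriers {u : U3Carriers} {β : HBeta}
    (hSM : ∀ b, 0 < b → b ≤ u.γ → ∀ s ∈ u.W, 1 / b ^ 2 = 1 / (s 0) ^ 2 + β 0 (fun _ => b) →
      ∀ (U : u.C.BgB) (X : u.C.Dom), |u.EA s (u.C.transport U) X - u.EB b s U X| ≤ u.C₅ * u.θ ^ u.C.scale X * Real.exp (-(u.κ * u.C.d X)))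
    {bsel : (ℕ → ℝ) → ℝ}
    (hbsel : ∀ s ∈ u.W, 0 < bsel s ∧ bsel s ≤ u.γ ∧ 1 / (bsel s) ^ 2 = 1 / (s 0) ^ 2 + β 0 (fun _ => bsel s)) :
    NE5 u.EA (fun s => u.EB (bsel s) s) u.W u.κ u.θ u.C₅ :=
  ne5_selector_of_stepMatched hSM hbsel

/-- ★ **THE N19′ LINK READING's THREE N18-SIDE OBLIGATIONS FROM THE LETTER**: at carriers with `u.W ⊆ Window u.γ`, the step-matched letter for `β` + the level-0 β-side binders
(sign, bound `β′`, continuity of `β₁` on `]0,γ]` — predecessors exist, §1 — and a Lipschitz modulus `Λ₀` with `Λ₀γ³ < 2` — they are unique) produce a selector `bsel` with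
(i) `hbsel : ∀ s ∈ u.W, 0 < bsel s ≤ u.γ`, (ii) `h18 : NE5 u.EA (fun s ↦ u.EB (bsel s) s) u.W …`, (iii) «first-coupling recovery» at every run of (0.20) of `β` with ≥ 1 step and
bare coupling in `]0,γ]`: `bsel (fun i ↦ gs (i+1)) = gs 0`.  All β-side inputs DISPLAYED (none printed as facts). [cite: Balaban1987RG1, (0.20) p.256, §1 pp.263–264, Thm 1 p.259] -/
theorem exists_selector_ne5_recovers_carriers {u : U3Carriers} {β : HBeta} {β' Λ₀ : ℝ}
    (hSM : ∀ b, 0 < b → b ≤ u.γ → ∀ s ∈ u.W, 1 / b ^ 2 = 1 / (s 0) ^ 2 + β 0 (fun _ => b) →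
      ∀ (U : u.C.BgB) (X : u.C.Dom), |u.EA s (u.C.transport U) X - u.EB b s U X| ≤ u.C₅ * u.θ ^ u.C.scale X * Real.exp (-(u.κ * u.C.d X)))
    (hWγ : u.W ⊆ Window u.γ)
    (hcont : ContinuousOn (fun b : ℝ => β 0 (fun _ => b)) (Set.Ioc 0 u.γ))
    (hsign : ∀ b, 0 < b → b ≤ u.γ → 0 ≤ β 0 (fun _ => b)) (hup : ∀ b, 0 < b → b ≤ u.γ → β 0 (fun _ => b) ≤ β')
    (hLip : ∀ b b', 0 < b → b ≤ u.γ → 0 < b' → b' ≤ u.γ → |β 0 (fun _ => b) - β 0 (fun _ => b')| ≤ Λ₀ * |b - b'|)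
    (hsmall : Λ₀ * u.γ ^ 3 < 2) :
    ∃ bsel : (ℕ → ℝ) → ℝ,
      (∀ s ∈ u.W, 0 < bsel s ∧ bsel s ≤ u.γ) ∧
      NE5 u.EA (fun s => u.EB (bsel s) s) u.W u.κ u.θ u.C₅ ∧
      (∀ (n : ℕ) (gs : ℕ → ℝ), RGEqH n β gs → 1 ≤ n → 0 < gs 0 ∧ gs 0 ≤ u.γ → bsel (fun i => gs (i + 1)) = gs 0) := by
  obtain ⟨bsel, hwin, hsel, h18⟩ := exists_selector_ne5_of_stepMatched (C := u.C) hSM hWγ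
    (fun x hx hxγ => by
      obtain ⟨b, hb, hbx, hm⟩ := exists_pred_of_sign_upper_cont hcont hsign hup hx hxγ
      exact ⟨b, hb, hbx.trans hxγ, hm⟩)
  have huniq : ∀ b b' x : ℝ, 0 < b → b ≤ u.γ → 0 < b' → b' ≤ u.γ →
      1 / b ^ 2 = 1 / x ^ 2 + β 0 (fun _ => b) → 1 / b' ^ 2 = 1 / x ^ 2 + β 0 (fun _ => b') → b = b' :=
    fun b b' x hb hbγ hb' hb'γ hm hm' => pred_unique_of_lipschitz₀ hLip hsmall hb hbγ hb' hb'γ hm hm'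
  exact ⟨bsel, fun s hs => hwin s (hWγ hs), h18, fun n gs hR hn h0 => selector_recovers_head_of_rgEqH hsel huniq hR hn h0⟩

/-- ★★ **(D4) + THE STEP-MATCHED LETTER ⟹ NE4 ALONG THE PREFIXES OF EVERY IN-WINDOW RUN OF THE DATUM** (the F-E-robust keying at K3's carriers, prefix currency):
`ReadOutAt D u` (the β-read-out binders of K3's rates predicate, `SpineRates` :151) supplies the read-outs, the slice classes on `u.W ⊇` padded boxes and the covariance with
`u.cr`; add the step-matched letter for `D.βfun` at `u` and a sequence `g^B` in `]0,u.γ]` up to index `K+1` obeying (0.20) of `D.βfun` at its first step ⟹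
`ShiftAlongRun (fun j ↦ u.cr·u.C₅·u.θ·u.θ^j) D.βfun g^B K`.  The box conjunct `N18At u` is NOT used. [cite: Balaban1987RG1, (0.18)–(0.20) pp.255–256, (1.20)–(1.22) p.264, Thm 1 p.259] -/
theorem shiftAlongRun_of_readOutAt_stepMatched (D : Datum F N) {u : U3Carriers} (hD4 : ReadOutAt D u)
    (hSM : ∀ b, 0 < b → b ≤ u.γ → ∀ s ∈ u.W, 1 / b ^ 2 = 1 / (s 0) ^ 2 + D.βfun 0 (fun _ => b) →
      ∀ (U : u.C.BgB) (X : u.C.Dom), |u.EA s (u.C.transport U) X - u.EB b s U X| ≤ u.C₅ * u.θ ^ u.C.scale X * Real.exp (-(u.κ * u.C.d X)))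
    {K : ℕ} {gB : ℕ → ℝ} (hstep0 : 1 / (gB 0) ^ 2 = 1 / (gB 1) ^ 2 + D.βfun 0 (fun _ => gB 0))
    (hbox : ∀ i, i ≤ K + 1 → 0 < gB i ∧ gB i ≤ u.γ) :
    ShiftAlongRun (fun j => u.cr * u.C₅ * u.θ * u.θ ^ j) D.βfun gB K := by
  obtain ⟨𝒜A, 𝒜B, rA, rB, hW, hA, hB, h𝒜A, h𝒜B, -, hcov, -⟩ := hD4
  exact shiftAlongRun_of_stepMatched hW hSM hA hB h𝒜A h𝒜B hcov hstep0 hbox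

/-- **… ALONG RUN `K+1` OF A TUNED SEQUENCE** ([Balaban1987RG1] Thm 2 p. 259: `g₀` tuned to `g` within `]0,γ]`, here `γ = u.γ`): with the printed-type `BetaUpperH β′ u.γ D.βfun`
and `u.γ²β′ < 1` (only to run (0.20) forward, `T4TwoRunUniqueness.rgEqH_of_tuned`), the datum's run `runFlow D g₀ (K+1)` is in the window and obeys (0.20), so the prefix-currency NE4
holds along it for EVERY `K` with ONE constant — exactly the input `hS` of `Necessity.u2Output_of_ne4AlongRuns`. [cite: Balaban1987RG1, (0.20) p.256 and Thm 2 p.259] -/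
theorem shiftAlongRun_runFlow_of_readOutAt_stepMatched (D : Datum F N) {u : U3Carriers} (hD4 : ReadOutAt D u)
    (hSM : ∀ b, 0 < b → b ≤ u.γ → ∀ s ∈ u.W, 1 / b ^ 2 = 1 / (s 0) ^ 2 + D.βfun 0 (fun _ => b) →
      ∀ (U : u.C.BgB) (X : u.C.Dom), |u.EA s (u.C.transport U) X - u.EB b s U X| ≤ u.C₅ * u.θ ^ u.C.scale X * Real.exp (-(u.κ * u.C.d X)))
    {β' g : ℝ} {g₀ : ℕ → ℝ} (hγ : 0 < u.γ) (hhi : BetaUpperH β' u.γ D.βfun) (hγβ : u.γ ^ 2 * β' < 1) (ht : D.Tuned u.γ g g₀) (K : ℕ) :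
    ShiftAlongRun (fun j => u.cr * u.C₅ * u.θ * u.θ ^ j) D.βfun (runFlow D g₀ (K + 1)) K := by
  obtain ⟨hbox, -⟩ := box_and_pin_of_tuned D ht
  have hrun : RGEqH (K + 1) D.βfun (runFlow D g₀ (K + 1)) := rgEqH_of_tuned D hhi hγβ hγ le_rfl ht (K + 1)
  have hstep0 := hrun 0 (Nat.succ_pos K)
  rw [prefixOf_zero_eq_const] at hstep0
  exact shiftAlongRun_of_readOutAt_stepMatched D hD4 hSM (by simpa using hstep0) (hbox (K + 1))

/-- ★ **NODE U2's OUTPUT ON THE DATUM FROM (D4) + THE STEP-MATCHED LETTER, END TO END** — the step-matched twin of `Spine/NE4/Targets.u2Output_of_u3` (there: the BOX letter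
`∀ b, NE5 EA (EB b) W`; here: the step-matched letter; the box-wide NE4 `N17At D u` is never formed): with the history half of node U2's triple on `D.βfun` (`HistLipschitz Λ u.γ`,
`FadingMemory C ρ Λ` at a rate `ρ ∈ [u.θ, 1[`, `0 < ρ`), the AF binders (`EventualLowerH b u.γ k₀`, `BetaUpperH β′ u.γ` with `u.γ²β′ < 1`), a sequence tuned within `]0,u.γ]`
and the window `C·((k₀+1)u.γ³ + 2u.γ∕b) ≤ (1−ρ)∕2` ⟹ `U2Output D g₀ (2·(u.cr·u.C₅·u.θ)∕(1−ρ)) ρ` (`Necessity.u2Output_of_ne4AlongRuns` BY NAME, after `θ^j ≤ ρ^j`).  Every β-side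
binder UNPRINTED ∕ displayed; (D4)'s letter signs supply `0 ≤ u.cr·u.C₅·u.θ`. [cite: Balaban1987RG1, (0.20) p.256, Thm 2 p.259, (1.20)–(1.22) p.264] -/
theorem u2Output_of_readOutAt_stepMatched (D : Datum F N) {u : U3Carriers} (hD4 : ReadOutAt D u)
    (hSM : ∀ b, 0 < b → b ≤ u.γ → ∀ s ∈ u.W, 1 / b ^ 2 = 1 / (s 0) ^ 2 + D.βfun 0 (fun _ => b) →
      ∀ (U : u.C.BgB) (X : u.C.Dom), |u.EA s (u.C.transport U) X - u.EB b s U X| ≤ u.C₅ * u.θ ^ u.C.scale X * Real.exp (-(u.κ * u.C.d X)))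
    {Λ : ℕ → ℕ → ℝ} {C ρ b β' g : ℝ} {k₀ : ℕ} {g₀ : ℕ → ℝ}
    (hθρ : u.θ ≤ ρ) (hρ0 : 0 < ρ) (hρ1 : ρ < 1)
    (hL : HistLipschitz Λ u.γ D.βfun) (hΛ : FadingMemory C ρ Λ)
    (hγ : 0 < u.γ) (hb : 0 < b) (hlo : EventualLowerH b u.γ k₀ D.βfun)
    (hhi : BetaUpperH β' u.γ D.βfun) (hγβ : u.γ ^ 2 * β' < 1) (ht : D.Tuned u.γ g g₀)
    (hsmall : C * (((k₀ : ℝ) + 1) * u.γ ^ 3 + 2 * u.γ / b) ≤ (1 - ρ) / 2) :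
    U2Output D g₀ (2 * (u.cr * u.C₅ * u.θ) / (1 - ρ)) ρ := by
  have hsigns : 0 ≤ u.cr ∧ 0 ≤ u.C₅ ∧ 0 ≤ u.θ := by obtain ⟨_, _, _, _, -, -, -, -, -, -, -, hcr, hC₅, hθ, -⟩ := hD4; exact ⟨hcr, hC₅, hθ⟩
  have hc : 0 ≤ u.cr * u.C₅ * u.θ := mul_nonneg (mul_nonneg hsigns.1 hsigns.2.1) hsigns.2.2
  refine u2Output_of_ne4AlongRuns D (c := u.cr * u.C₅ * u.θ) (fun K => ?_) hρ0 hρ1 hc hL hΛ hγ hb hlo hhi hγβ ht hsmall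
  intro j hj
  have h := shiftAlongRun_runFlow_of_readOutAt_stepMatched D hD4 hSM hγ hhi hγβ ht K j hj
  have hpow : u.θ ^ j ≤ ρ ^ j := pow_le_pow_left₀ hsigns.2.2 hθρ j
  exact h.trans (mul_le_mul_of_nonneg_left hpow hc)

end Carriers

end YMDAG.N18.StepMatchedLetter

end
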